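import Summits.QuantumFields.BalabanUV.Beta.D1BFx.ColumnGaugeTwoPins
import Summits.QuantumFields.BalabanUV.Beta.D1BFx.ColumnGaugeSecondOrder
import Summits.QuantumFields.BalabanUV.Beta.D1BFx.CombPairSlotLetters
import Summits.QuantumFields.BalabanUV.Beta.D1BFx.ColumnGaugeNativeFirstOrder
import Summits.QuantumFields.BalabanUV.Beta.D1BFx.ChartDefectWords
import Summits.QuantumFields.BalabanUV.Beta.CombSecondOrderClassBase
import Summits.QuantumFields.BalabanUV.Beta.SymCorrectorLiteralLoc
import Summits.QuantumFields.BalabanUV.Beta.SymCorrectorResponseNull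
import Summits.QuantumFields.BalabanUV.Beta.SymTablesAn1FirstOrder
import Summits.QuantumFields.BalabanUV.Beta.CombChartWardSockets

/-!
# `BalabanUV.Beta.D1BFx.ChartDefectLiteralColumnPin` — road «BF-x», binder row D1, PART 24 HEAD (H3-literal, COLUMN LAYER) at the RECORD
# (`PART24-HEAD-SPEC-g24.md` v1.1 §3; an2 R-D1-g45-5: «identities at both pins FIRST»): **AT THE LITERAL's PROPAGATOR `G′ = GcombSh n 0` THE COLUMN
# DRESSING OF THE ROAD's KERNEL CANCELS COMPLETELY** — for the literal of record at lockB (`cB = −n¹²∕4`), every `Loc` family `X`, and the literal's level-0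
# tables `S⁰, S♭, M⁰, S₂⁰, M₂⁰`,
# `hessKer G′ (vertexOfK G₀ n S⁰) (W2SymOfK G₀ n S♭ M⁰ S₂⁰ M₂⁰ + X) = hessKer G′ (vertexOfK K₀ n S⁰) (W2SymOfK K₀ n S♭ M⁰ S₂⁰ M₂⁰ + W^{Λ}_c + W^{Mcol}_c + X)`,
# `G₀ = coDressKBmAt ρ_c n K₀`, `K₀ = KInvStep n 0`: the letters' partner `bhK + Dsh` IS the relative-inverse partner of `G′` (`RelInv G′ (bhK + Dsh) axEc`), so
# `ColumnGaugeTwoPins.hessKer_GcombSh_cancel` kills the first-order word `[Λc, bhK + Dsh]`, the pair word `Wmix(Λc; V^s)` and the gauge–gauge word `Wgg(Λc; bhK + Dsh)`;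
# what is DISPLACED (named, not bounded): the Λ-sector word `W^{Λ}_c := Wmix(Λc; vertexOfK K₀ n S♭) − Wmix(Λc; vertexOfK K₀ n S⁰)` (the same word as on the road
# side, `ChartDefectTwoPinsRoad`) and the column half of the mixed words `W^{Mcol}_c μ y ν y′ := (mixOfK G₀ n M₂⁰ − mixOfK K₀ n M₂⁰) μ y ν y′ + (ν y′ μ y)`
# (letter-free; its evaluation is leaf-01's `DressedMixVertexSplit.mixOfK_coDressKBmAt_eq_sub`); the two symmetrised RESPONSE words
# `½•dM (K2OfK K′ n S♭ M⁰ ν y′) n S♭ M⁰ μ y + swap` (`K′ = G₀`, `K₀`) are tadpole-null at `G′` by ROW PARITY (`SpineRecursiveParity.tadpole_dM_eq_zero_of_rows`,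
# `trK G′ = sgnK G′`, `trK (S♭ κ u) = −sgnK`, `trK (M⁰ ρ w) = −sgnK`) and drop (`Nr′`).

HONEST DEPENDENCY (cell records, verbatim): «continuum YM on T⁴ ⇐ BetaPertH ∧ nine spine estimates (0/9 proved); BetaPertH ⇐ (D1) ∧ (D4) ∧
CAP+tail; G-an2-4 gates asym, D1 and NE2/3/4.»  HONEST FRAMING (cell contract, verbatim): «discharging `BetaPertH` makes Bałaban's UV stability
UNCONDITIONAL — a real constructive-QFT result; it is NOT the continuum limit and NOT the Clay problem.»  THIS MODULE DISCHARGES NO binder of row D1 and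
NO estimate of Bałaban's: one [our object] identity between OUR kernels composed BY NAME (leaf-01 g31's `ColumnGaugeSecondOrder`, the record's letters
`CombPairSlotLetters`, leaf-03 g31's `SymCorrectorLiteralLoc` ∕ `SymCorrectorResponseNull` sockets, an1∕leaf-05's parities); the colour data `Complete τ`,
`TrOrthonormal τ`, `N ≠ 0` are HYPOTHESES (displayed); prices NO row; no definition, no `def … : Prop`, nothing cited, 0 sorry.  0∕4 row-D1 binders; (K) NOT
closed; (J1) ONE OPEN ROW; NOT D1, NEVER «G-an2-4 closed», NOT `BetaPertH`, NOT continuum, NOT Clay.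

ABSOLUTE RULE (cell charter, verbatim): «No internally-minted statement may enter as a cited fact. Every hypothesis is either kernel-proved in this
package or a verbatim quotation of a PUBLISHED theorem with page reference. The manuscript(s) under audit are NOT citable for their own disputed
steps — they are the thing under adjudication; programme-internal (2001/route/tribunal) claims are never citable.»

Unit `b2b-balaban-beta-d1-p2` (road owner, gen 24), 2026-08-23; no existing file touched.
-/

noncomputable section

namespace Summit.QuantumFields.BalabanUV.Beta.D1BFx.ChartDefectLiteralColumnPin

open Literature.MathematicalPhysics.QuantumFieldTheory
open Literature.MathematicalPhysics.QuantumFieldTheory.LatticeForm (quo)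
open Literature.MathematicalPhysics.QuantumFieldTheory.Balaban1983to89
open Literature.MathematicalPhysics.QuantumFieldTheory.Balaban1983to89.Beta
open B4ContourShift (supNorm)
open ColourTrace (Complete TrOrthonormal)
open WilsonVertex2Sym (wsym22)
open WilsonBiStencil (wilsonW₂)
open StepJetData (wilsonA)
open KernelReflection (tadpole_smul)
open ExpKernelCalculus (MKer VertexFamily comp hessKer tadpole)
open OneStepResolventKernel (Fib LocStencil)
open OneStepKernelFamily (colH vertexOfK KInvStep)
open SecondOrderResponse (dM K2OfK mixOfK W2OfK W2OfK_apply W2SymOfK vertex2OfK LocStencilFM)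
open BalabanCompositeJets (LocStencil₂)
open BalabanStepW2 (M2Of)
open AffineAveraging (Site box toSite)
open AveragingContoursRooted (ctr ctrOff ctrOff_mem_box)
open Summit.QuantumFields.BalabanUV.Beta.TameKernelCalculus (Spr Loc trK tadpole_add)
open Summit.QuantumFields.BalabanUV.Beta.KernelWardRelative (tadpole_sub)
open Summit.QuantumFields.BalabanUV.Beta.BorderedHessian (diagK bhK sgnK spr_KInvStep comp_diagK_left comp_diagK_right)
open Summit.QuantumFields.BalabanUV.Beta.DshAn1 (Dsh)
open Summit.QuantumFields.BalabanUV.Beta.AxialDressingRooted (coDressKBmAt axEc)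
open Summit.QuantumFields.BalabanUV.Beta.AxialProjectorBlockMean (bmGaugeAt)
open Summit.QuantumFields.BalabanUV.Beta.AveragingWardRootedStencils (legSite)
open Summit.QuantumFields.BalabanUV.Beta.SymAveragingHessianCounts (symVhSAt)
open Summit.QuantumFields.BalabanUV.Beta.SymSecondOrderTablesAn1 (symVh₂SAn1 symTablesAn1S2)
open Summit.QuantumFields.BalabanUV.Beta.CombChartStepJets (GcombSh JsB12CombSh0)
open Summit.QuantumFields.BalabanUV.Beta.CombChartWardSockets (trK_GcombSh)
open Summit.QuantumFields.BalabanUV.Beta.SpineRooted (T2RecOf_zero_level)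
open Summit.QuantumFields.BalabanUV.Beta.SpineRecursiveParity (tadpole_dM_eq_zero_of_rows trK_wilsonA parityOdd_smul)
open Summit.QuantumFields.BalabanUV.Beta.KernelWardRemainderParity (parityOdd_add)
open Summit.QuantumFields.BalabanUV.Beta.SymTablesAn1FirstOrder (trK_symVhSAt trK_M1Of_symHessFFAt)
open Summit.QuantumFields.BalabanUV.Beta.CombSecondOrderClassBase (locStencil₂_T2RecOf_symTablesAn1)
open Summit.QuantumFields.BalabanUV.Beta.SymCorrectorLiteralLoc (locStencilFM_literalM₂ loc_mixOfK_of_spr)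
open Summit.QuantumFields.BalabanUV.Beta.SymCorrectorResponseNull (loc_dM_K2OfK)
open Summit.QuantumFields.BalabanUV.Beta.D1BFx.ChartDefectResolvent (spr_G0bm_ctr spr_GcombSh_zero)
open Summit.QuantumFields.BalabanUV.Beta.D1BFx.RawStencilSupportRows (locStencil_JsB12CombSh0_S_zero_of_decays locStencil_pure_zero)
open Summit.QuantumFields.BalabanUV.Beta.D1BFx.PackedColumnEnvelope (abs_colH_KInvStep_zero_le)
open Summit.QuantumFields.BalabanUV.Beta.D1BFx.DressedVertexSplit (abs_bmGaugeAt_weight_le)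
open Summit.QuantumFields.BalabanUV.Beta.D1BFx.ColumnGaugeGenerator (comp_generator_axEc_comm)
open Summit.QuantumFields.BalabanUV.Beta.D1BFx.ColumnGaugeNativeFirstOrder (loc_diagK_weight_legSite)
open Summit.QuantumFields.BalabanUV.Beta.D1BFx.ColumnGaugeCombPartner (vertexOfK_G0bm_S_zero_eq_add_comm)
open Summit.QuantumFields.BalabanUV.Beta.D1BFx.ColumnGaugeSecondOrder (vertex2OfK_coDressKBmAt_eq_add_Wmix_Wgg_one)
open Summit.QuantumFields.BalabanUV.Beta.D1BFx.CombPairSlotLetters (hL_record hR_record hT_record)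
open Summit.QuantumFields.BalabanUV.Beta.D1BFx.ColumnGaugeTwoPins (hessKer_GcombSh_cancel)
open Summit.QuantumFields.BalabanUV.Beta.D1BFx.ChartDefectWords (loc_vertexOfK_of_spr loc_vertex2OfK_of_spr)
open B5Hk163Strip (kappa163 kappa163_pos)
open B5Hk163Decay (MG163)
open B4TorusKernel (periodConst)

variable {n : ℕ} [NeZero n] {N : ℕ} {C : Type*} [Fintype C] [DecidableEq C] {τ : C → Matrix (Fin N) (Fin N) ℂ}

/-- [folklore] **THE GAUGE–GAUGE WORD OF DIAGONAL GENERATORS IS SWAP-SYMMETRIC**: for diagonal `Λ₁ = diagK f`, `Λ₂ = diagK g` and any `𝕄`,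
`Λ₂∘[Λ₁, 𝕄] − [Λ₁, 𝕄]∘Λ₂ = Λ₁∘[Λ₂, 𝕄] − [Λ₂, 𝕄]∘Λ₁` (diagonal kernels commute; entrywise `ring`). -/
theorem Wgg_diagK_swap {d : ℕ} (f g : (Fin (d + 1) → ℤ) → Fib d → ℝ) (𝕄 : MKer (d + 1) (Fib d)) :
    comp (diagK g) (comp (diagK f) 𝕄 - comp 𝕄 (diagK f)) - comp (comp (diagK f) 𝕄 - comp 𝕄 (diagK f)) (diagK g)
      = comp (diagK f) (comp (diagK g) 𝕄 - comp 𝕄 (diagK g)) - comp (comp (diagK g) 𝕄 - comp 𝕄 (diagK g)) (diagK f) := by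
  funext x z a b
  simp only [Pi.sub_apply, comp_diagK_left, comp_diagK_right]
  ring

/-- **THE LITERAL's PROPAGATOR CANCELS THE COLUMN DRESSING OF THE ROAD's KERNEL** [our object] (the (H3-literal) identity, COLUMN layer, at the literal
of record, lockB `cB = −n¹²∕4`): with `G′ := GcombSh n 0`, `G₀ := coDressKBmAt ρ_c n K₀`, `K₀ := KInvStep n 0`, the record's tables `S⁰` (full first-order),
`S♭ := n⁴•wilsonA + (−n⁸∕2)•symVhSAt ρ_c` (its `Λ`-free part), `M⁰ := (symTablesAn1S2 3 n cΛ).M 0`, `S₂⁰`, `M₂⁰ := M2Of 3 n (symTablesAn1S2 3 n cΛ).mixFF 0`,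
`Λc μ y := diagK (z b ↦ (n⁴∕2)·bmGaugeAt ρ_c (colH K₀ n μ y) n (legSite ρ_c z b))`, and ANY localised family `X`,
`hessKer G′ (vertexOfK G₀ n S⁰) (W2SymOfK G₀ n S♭ M⁰ S₂⁰ M₂⁰ + X) μ ν z
 = hessKer G′ (vertexOfK K₀ n S⁰) (μ y ν y′ ↦ W2SymOfK K₀ n S♭ M⁰ S₂⁰ M₂⁰ μ y ν y′ + W^{Λ}_c μ y ν y′ + W^{Mcol}_c μ y ν y′ + X μ y ν y′) μ ν z`,
`W^{Λ}_c := Wmix(Λc; vertexOfK K₀ n S♭) − Wmix(Λc; vertexOfK K₀ n S⁰)`, `W^{Mcol}_c μ y ν y′ := (mixOfK G₀ n M₂⁰ μ y ν y′ − mixOfK K₀ n M₂⁰ μ y ν y′)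
+ (mixOfK G₀ n M₂⁰ ν y′ μ y − mixOfK K₀ n M₂⁰ ν y′ μ y)`. -/
theorem hessKer_GcombSh_columnPin_record (hodd : Odd n) (hτ : Complete τ) (ho : TrOrthonormal τ) (hN : N ≠ 0) (c : C) (cΛ : ℝ)
    (X : Fin 4 → Site 4 → Fin 4 → Site 4 → MKer (3 + 1) (Fib 3)) (hX : ∀ μ y ν y', Loc (X μ y ν y'))
    (μ ν : Fin 4) (z : Site 4) :
    hessKer (GcombSh (d := 3) n 0)
        (vertexOfK (coDressKBmAt (ctr 4 n) n (KInvStep (d := 3) n 0)) n (JsB12CombSh0 hodd N (symTablesAn1S2 3 n cΛ) cΛ (-((n : ℝ) ^ 12 / 4)) 0).S)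
        (fun μ' y ν' y' =>
          W2SymOfK (coDressKBmAt (ctr 4 n) n (KInvStep (d := 3) n 0)) n
              (fun κ u => ((n : ℝ) ^ 4) • wilsonA 3 κ u + (-((n : ℝ) ^ 8 / 2)) • symVhSAt (ctr 4 n) 3 n rfl κ u)
              ((symTablesAn1S2 3 n cΛ).M 0)
              (fun κ u κ' u' => ((n : ℝ) ^ 8) • wilsonW₂ 3 ((8 * (N : ℝ) ^ 2)⁻¹ • wsym22 N) κ u κ' u' + (-((n : ℝ) ^ 12 / 4)) • symVh₂SAn1 3 n κ u κ' u')
              (M2Of 3 n (symTablesAn1S2 3 n cΛ).mixFF 0) μ' y ν' y'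
            + X μ' y ν' y')
        μ ν z
      = hessKer (GcombSh (d := 3) n 0)
        (vertexOfK (KInvStep (d := 3) n 0) n (JsB12CombSh0 hodd N (symTablesAn1S2 3 n cΛ) cΛ (-((n : ℝ) ^ 12 / 4)) 0).S)
        (fun μ' y ν' y' =>
          W2SymOfK (KInvStep (d := 3) n 0) n
              (fun κ u => ((n : ℝ) ^ 4) • wilsonA 3 κ u + (-((n : ℝ) ^ 8 / 2)) • symVhSAt (ctr 4 n) 3 n rfl κ u)
              ((symTablesAn1S2 3 n cΛ).M 0)
              (fun κ u κ' u' => ((n : ℝ) ^ 8) • wilsonW₂ 3 ((8 * (N : ℝ) ^ 2)⁻¹ • wsym22 N) κ u κ' u' + (-((n : ℝ) ^ 12 / 4)) • symVh₂SAn1 3 n κ u κ' u')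
              (M2Of 3 n (symTablesAn1S2 3 n cΛ).mixFF 0) μ' y ν' y'
          -- `W^{Λ}_c`: the Λ-sector's missing `Wmix` (letters' partner is `S♭`, the road reads `S⁰`)
          + (((comp (diagK fun z' b => (n : ℝ) ^ 4 / 2 * bmGaugeAt (ctr 4 n) (colH (KInvStep (d := 3) n 0) n ν' y') n (legSite (ctr 4 n) z' b))
                  (vertexOfK (KInvStep (d := 3) n 0) n (fun κ u => ((n : ℝ) ^ 4) • wilsonA 3 κ u + (-((n : ℝ) ^ 8 / 2)) • symVhSAt (ctr 4 n) 3 n rfl κ u) μ' y)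
                - comp (vertexOfK (KInvStep (d := 3) n 0) n (fun κ u => ((n : ℝ) ^ 4) • wilsonA 3 κ u + (-((n : ℝ) ^ 8 / 2)) • symVhSAt (ctr 4 n) 3 n rfl κ u) μ' y)
                  (diagK fun z' b => (n : ℝ) ^ 4 / 2 * bmGaugeAt (ctr 4 n) (colH (KInvStep (d := 3) n 0) n ν' y') n (legSite (ctr 4 n) z' b)))
              + (comp (diagK fun z' b => (n : ℝ) ^ 4 / 2 * bmGaugeAt (ctr 4 n) (colH (KInvStep (d := 3) n 0) n μ' y) n (legSite (ctr 4 n) z' b))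
                  (vertexOfK (KInvStep (d := 3) n 0) n (fun κ u => ((n : ℝ) ^ 4) • wilsonA 3 κ u + (-((n : ℝ) ^ 8 / 2)) • symVhSAt (ctr 4 n) 3 n rfl κ u) ν' y')
                - comp (vertexOfK (KInvStep (d := 3) n 0) n (fun κ u => ((n : ℝ) ^ 4) • wilsonA 3 κ u + (-((n : ℝ) ^ 8 / 2)) • symVhSAt (ctr 4 n) 3 n rfl κ u) ν' y')
                  (diagK fun z' b => (n : ℝ) ^ 4 / 2 * bmGaugeAt (ctr 4 n) (colH (KInvStep (d := 3) n 0) n μ' y) n (legSite (ctr 4 n) z' b))))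
            - ((comp (diagK fun z' b => (n : ℝ) ^ 4 / 2 * bmGaugeAt (ctr 4 n) (colH (KInvStep (d := 3) n 0) n ν' y') n (legSite (ctr 4 n) z' b))
                  (vertexOfK (KInvStep (d := 3) n 0) n (JsB12CombSh0 hodd N (symTablesAn1S2 3 n cΛ) cΛ (-((n : ℝ) ^ 12 / 4)) 0).S μ' y)
                - comp (vertexOfK (KInvStep (d := 3) n 0) n (JsB12CombSh0 hodd N (symTablesAn1S2 3 n cΛ) cΛ (-((n : ℝ) ^ 12 / 4)) 0).S μ' y)
                  (diagK fun z' b => (n : ℝ) ^ 4 / 2 * bmGaugeAt (ctr 4 n) (colH (KInvStep (d := 3) n 0) n ν' y') n (legSite (ctr 4 n) z' b)))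
              + (comp (diagK fun z' b => (n : ℝ) ^ 4 / 2 * bmGaugeAt (ctr 4 n) (colH (KInvStep (d := 3) n 0) n μ' y) n (legSite (ctr 4 n) z' b))
                  (vertexOfK (KInvStep (d := 3) n 0) n (JsB12CombSh0 hodd N (symTablesAn1S2 3 n cΛ) cΛ (-((n : ℝ) ^ 12 / 4)) 0).S ν' y')
                - comp (vertexOfK (KInvStep (d := 3) n 0) n (JsB12CombSh0 hodd N (symTablesAn1S2 3 n cΛ) cΛ (-((n : ℝ) ^ 12 / 4)) 0).S ν' y')
                  (diagK fun z' b => (n : ℝ) ^ 4 / 2 * bmGaugeAt (ctr 4 n) (colH (KInvStep (d := 3) n 0) n μ' y) n (legSite (ctr 4 n) z' b)))))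
          -- `W^{Mcol}_c`: the column half of the mixed words (letter-free: the difference, both bond orders)
          + ((mixOfK (coDressKBmAt (ctr 4 n) n (KInvStep (d := 3) n 0)) n (M2Of 3 n (symTablesAn1S2 3 n cΛ).mixFF 0) μ' y ν' y'
                - mixOfK (KInvStep (d := 3) n 0) n (M2Of 3 n (symTablesAn1S2 3 n cΛ).mixFF 0) μ' y ν' y')
            + (mixOfK (coDressKBmAt (ctr 4 n) n (KInvStep (d := 3) n 0)) n (M2Of 3 n (symTablesAn1S2 3 n cΛ).mixFF 0) ν' y' μ' y
                - mixOfK (KInvStep (d := 3) n 0) n (M2Of 3 n (symTablesAn1S2 3 n cΛ).mixFF 0) ν' y' μ' y))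
          + X μ' y ν' y')
        μ ν z := by
  -- abbreviations
  set K₀ : MKer (3 + 1) (Fib 3) := KInvStep (d := 3) n 0 with hK₀def
  set G₀ : MKer (3 + 1) (Fib 3) := coDressKBmAt (ctr 4 n) n K₀ with hG₀def
  set S0 := (JsB12CombSh0 hodd N (symTablesAn1S2 3 n cΛ) cΛ (-((n : ℝ) ^ 12 / 4)) 0).S with hS0def
  set Sfl : Fin (3 + 1) → Site (3 + 1) → MKer (3 + 1) (Fib 3) :=
    fun κ u => ((n : ℝ) ^ 4) • wilsonA 3 κ u + (-((n : ℝ) ^ 8 / 2)) • symVhSAt (ctr 4 n) 3 n rfl κ u with hSfldef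
  set M0 := (symTablesAn1S2 3 n cΛ).M 0 with hM0def
  set S₂ : Fin (3 + 1) → Site (3 + 1) → Fin (3 + 1) → Site (3 + 1) → MKer (3 + 1) (Fib 3) :=
    fun κ u κ' u' => ((n : ℝ) ^ 8) • wilsonW₂ 3 ((8 * (N : ℝ) ^ 2)⁻¹ • wsym22 N) κ u κ' u' + (-((n : ℝ) ^ 12 / 4)) • symVh₂SAn1 3 n κ u κ' u' with hS₂def
  set M₂ := M2Of 3 n (symTablesAn1S2 3 n cΛ).mixFF 0 with hM₂def
  have hn1 : 1 ≤ n := Nat.one_le_iff_ne_zero.2 (NeZero.ne n)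
  have hn0 : 0 < n := hn1
  -- structural facts about the kernels and the record's tables
  have hK₀ : Spr K₀ := spr_KInvStep (d := 3) (Lc := n) 0
  have hG₀ : Spr G₀ := spr_G0bm_ctr (d := 3) (Lc := n)
  have hG' : Spr (GcombSh (d := 3) n 0) := spr_GcombSh_zero (d := 3) (Lc := n)
  have hKdec : ∃ δ C : ℝ, 0 < δ ∧ 0 ≤ C ∧ ExpKernelCalculus.Decays K₀ C δ := OneStepKernelFamily.decays_KInvStep (Lc := n) (d := 3) 0
  obtain ⟨δK, CK, hδK, hCK, hKd⟩ := OneStepResolventKernel.decays_KInv (N := n) (d := 3)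
  obtain ⟨Cs, -, hS⟩ := locStencil_JsB12CombSh0_S_zero_of_decays hodd N (symTablesAn1S2 3 n cΛ) cΛ (-((n : ℝ) ^ 12 / 4)) hKd hCK hδK
  obtain ⟨Cfl, -, hSfl⟩ := locStencil_pure_zero (n := n) (symTablesAn1S2 3 n cΛ) (δ := 1) zero_le_one
  obtain ⟨CM, δM, hδM, hM0⟩ := (symTablesAn1S2 3 n cΛ).hM 0
  obtain ⟨C₂, δ₂, hδ₂, hS₂⟩ := locStencil₂_T2RecOf_symTablesAn1 (Lc := n) N cΛ 0
  rw [T2RecOf_zero_level] at hS₂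
  have hC₂ : 0 ≤ C₂ := hS₂.nonneg
  obtain ⟨CF, δF, hδF, hM₂⟩ := locStencilFM_literalM₂ n (symTablesAn1S2 3 n cΛ)
  -- g53's block envelope of the straight column (both bonds)
  have hcol : ∀ (μ' : Fin (3 + 1)) (y : Site (3 + 1)) (κ : Fin (3 + 1)) (u : Site (3 + 1)), |colH K₀ n μ' y κ u|
      ≤ ((n : ℝ) ^ (3 + 2))⁻¹ * (MG163 (3 + 1) * periodConst (kappa163 (3 + 1)) 3)
          * Real.exp (-(kappa163 (3 + 1) / ((3 : ℝ) + 1) * supNorm (quo n u - y))) :=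
    fun μ' y κ u => abs_colH_KInvStep_zero_le (d := 3) (N := n) hn1 μ' y κ u
  have hM : 0 ≤ ((n : ℝ) ^ (3 + 2))⁻¹ * (MG163 (3 + 1) * periodConst (kappa163 (3 + 1)) 3) :=
    (mul_nonneg_iff_of_pos_right (Real.exp_pos _)).1 ((abs_nonneg _).trans (hcol 0 0 0 0))
  have hc : 0 < kappa163 (3 + 1) / ((3 : ℝ) + 1) := div_pos (kappa163_pos (3 + 1)) (by positivity)
  -- the generator is localised and commutes with the slice projector
  have hΛ : ∀ μ' y, Loc (diagK fun z' b => (n : ℝ) ^ 4 / 2 * bmGaugeAt (ctr 4 n) (colH K₀ n μ' y) n (legSite (ctr 4 n) z' b)) := fun μ' y => by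
    have hn0' : (0 : ℝ) < n := by exact_mod_cast hn1
    have hχ := abs_bmGaugeAt_weight_le hn1 (ctrOff_mem_box hn1) K₀ μ' y hM hc.le (hcol μ' y)
    exact loc_diagK_weight_legSite (by positivity) (by positivity) hχ (ctr 4 n) ((n : ℝ) ^ 4 / 2)
  have hΛE : ∀ μ' y, comp (diagK fun z' b => (n : ℝ) ^ 4 / 2 * bmGaugeAt (ctr 4 n) (colH K₀ n μ' y) n (legSite (ctr 4 n) z' b)) (axEc (ctr (3 + 1) n) n)
      = comp (axEc (ctr (3 + 1) n) n) (diagK fun z' b => (n : ℝ) ^ 4 / 2 * bmGaugeAt (ctr 4 n) (colH K₀ n μ' y) n (legSite (ctr 4 n) z' b)) :=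
    fun μ' y => comp_generator_axEc_comm _ _ _
  -- localisation of the straight families, of the mixed and the response words
  have hV : ∀ μ' y, Loc (vertexOfK K₀ n S0 μ' y) := fun μ' y => loc_vertexOfK_of_spr hK₀ hS (half_pos hδK) μ' y
  have hVfl : ∀ μ' y, Loc (vertexOfK K₀ n Sfl μ' y) := fun μ' y => loc_vertexOfK_of_spr hK₀ hSfl one_pos μ' y
  have hW2 : ∀ μ' y ν' y', Loc (vertex2OfK K₀ n S₂ μ' y ν' y') := fun μ' y ν' y' => loc_vertex2OfK_of_spr hK₀ hS₂ hC₂ hδ₂ μ' y ν' y'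
  have hmixG : ∀ μ' y ν' y', Loc (mixOfK G₀ n M₂ μ' y ν' y') := fun μ' y ν' y' => loc_mixOfK_of_spr hG₀ hM₂ hδF μ' y ν' y'
  have hmixK : ∀ μ' y ν' y', Loc (mixOfK K₀ n M₂ μ' y ν' y') := fun μ' y ν' y' => loc_mixOfK_of_spr hK₀ hM₂ hδF μ' y ν' y'
  have hRG : ∀ μ' y ν' y', Loc (dM (K2OfK G₀ n Sfl M0 ν' y') n Sfl M0 μ' y) := fun μ' y ν' y' =>
    loc_dM_K2OfK hn0 hG₀ hSfl one_pos hM0 hδM ν' y' μ' y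
  have hRK : ∀ μ' y ν' y', Loc (dM (K2OfK K₀ n Sfl M0 ν' y') n Sfl M0 μ' y) := fun μ' y ν' y' =>
    loc_dM_K2OfK hn0 hK₀ hSfl one_pos hM0 hδM ν' y' μ' y
  have hW2K : ∀ μ' y ν' y', Loc (W2SymOfK K₀ n Sfl M0 S₂ M₂ μ' y ν' y') := fun μ' y ν' y' => by
    unfold W2SymOfK
    exact (((((hW2 μ' y ν' y').add (hmixK μ' y ν' y')).add (hmixK ν' y' μ' y)).add (hRK μ' y ν' y')).add
      ((((hW2 ν' y' μ' y).add (hmixK ν' y' μ' y)).add (hmixK μ' y ν' y')).add (hRK ν' y' μ' y))).smul _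
  -- ROW PARITY: the response words are tadpole-null at `G′`
  have hGt : trK (GcombSh (d := 3) n 0) = sgnK (GcombSh (d := 3) n 0) := trK_GcombSh (d := 3) (Lc := n) 0
  have hSrow : ∀ κ u, trK (Sfl κ u) = -sgnK (Sfl κ u) := fun κ u =>
    parityOdd_add (parityOdd_smul _ (trK_wilsonA (d := 3) κ u)) (parityOdd_smul _ (trK_symVhSAt (ctr 4 n) n κ u))
  have hMrow : ∀ ρ w, trK (M0 ρ w) = -sgnK (M0 ρ w) := fun ρ w => trK_M1Of_symHessFFAt (ctr (3 + 1) n) cΛ 0 ρ w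
  have h0G : ∀ μ' y ν' y', tadpole (GcombSh (d := 3) n 0) (dM (K2OfK G₀ n Sfl M0 ν' y') n Sfl M0 μ' y) = 0 := fun μ' y ν' y' =>
    tadpole_dM_eq_zero_of_rows hG' hGt _ n hSrow hMrow μ' y (hRG μ' y ν' y')
  have h0K : ∀ μ' y ν' y', tadpole (GcombSh (d := 3) n 0) (dM (K2OfK K₀ n Sfl M0 ν' y') n Sfl M0 μ' y) = 0 := fun μ' y ν' y' =>
    tadpole_dM_eq_zero_of_rows hG' hGt _ n hSrow hMrow μ' y (hRK μ' y ν' y')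
  -- FIRST ORDER: `V^{bm} = V^s + [Λc, bhK + Dsh]` (ColumnGaugeCombPartner §3)
  have eV : vertexOfK G₀ n S0 = fun μ' y => vertexOfK K₀ n S0 μ' y
      + (comp (diagK fun z' b => (n : ℝ) ^ 4 / 2 * bmGaugeAt (ctr 4 n) (colH K₀ n μ' y) n (legSite (ctr 4 n) z' b)) (bhK n + Dsh n)
        - comp (bhK n + Dsh n) (diagK fun z' b => (n : ℝ) ^ 4 / 2 * bmGaugeAt (ctr 4 n) (colH K₀ n μ' y) n (legSite (ctr 4 n) z' b))) :=
    funext fun μ' => funext fun y => vertexOfK_G0bm_S_zero_eq_add_comm hodd N cΛ (-((n : ℝ) ^ 12 / 4)) μ' y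
  -- SECOND ORDER (pair table): leaf-01's one-table identity with the record's three letters, either bond order
  have eP : ∀ μ' y ν' y', vertex2OfK G₀ n S₂ μ' y ν' y' = vertex2OfK K₀ n S₂ μ' y ν' y'
      + (((comp (diagK fun z' b => (n : ℝ) ^ 4 / 2 * bmGaugeAt (ctr 4 n) (colH K₀ n ν' y') n (legSite (ctr 4 n) z' b)) (vertexOfK K₀ n Sfl μ' y)
            - comp (vertexOfK K₀ n Sfl μ' y) (diagK fun z' b => (n : ℝ) ^ 4 / 2 * bmGaugeAt (ctr 4 n) (colH K₀ n ν' y') n (legSite (ctr 4 n) z' b)))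
          + (comp (diagK fun z' b => (n : ℝ) ^ 4 / 2 * bmGaugeAt (ctr 4 n) (colH K₀ n μ' y) n (legSite (ctr 4 n) z' b)) (vertexOfK K₀ n Sfl ν' y')
            - comp (vertexOfK K₀ n Sfl ν' y') (diagK fun z' b => (n : ℝ) ^ 4 / 2 * bmGaugeAt (ctr 4 n) (colH K₀ n μ' y) n (legSite (ctr 4 n) z' b))))
        + (comp (diagK fun z' b => (n : ℝ) ^ 4 / 2 * bmGaugeAt (ctr 4 n) (colH K₀ n μ' y) n (legSite (ctr 4 n) z' b))
              (comp (diagK fun z' b => (n : ℝ) ^ 4 / 2 * bmGaugeAt (ctr 4 n) (colH K₀ n ν' y') n (legSite (ctr 4 n) z' b)) (bhK n + Dsh n)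
                - comp (bhK n + Dsh n) (diagK fun z' b => (n : ℝ) ^ 4 / 2 * bmGaugeAt (ctr 4 n) (colH K₀ n ν' y') n (legSite (ctr 4 n) z' b)))
            - comp (comp (diagK fun z' b => (n : ℝ) ^ 4 / 2 * bmGaugeAt (ctr 4 n) (colH K₀ n ν' y') n (legSite (ctr 4 n) z' b)) (bhK n + Dsh n)
                - comp (bhK n + Dsh n) (diagK fun z' b => (n : ℝ) ^ 4 / 2 * bmGaugeAt (ctr 4 n) (colH K₀ n ν' y') n (legSite (ctr 4 n) z' b)))
              (diagK fun z' b => (n : ℝ) ^ 4 / 2 * bmGaugeAt (ctr 4 n) (colH K₀ n μ' y) n (legSite (ctr 4 n) z' b)))) := fun μ' y ν' y' => by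
    have h := vertex2OfK_coDressKBmAt_eq_add_Wmix_Wgg_one hn1 (ctrOff_mem_box hn1) hKdec hS₂ hδ₂ μ' y ν' y' hM hc (hcol μ' y) (hcol ν' y')
      (S := Sfl) (𝕄 := bhK n + Dsh n) (ρ := ctr 4 n) (ξ := (n : ℝ) ^ 4 / 2)
      (fun κ' u' w => hL_record (n := n) hτ ho hN c κ' u' w) (fun α x w' => hR_record (n := n) hτ ho hN c α x w')
      (fun w' => hT_record hodd N cΛ (-((n : ℝ) ^ 12 / 4)) w')
    rw [show toSite (ctrOff (3 + 1) n) = ctr 4 n from rfl] at h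
    exact h
  -- the W slot regrouped: straight carrier + displaced words + (Wmix(Λc; V^s) + Wgg) + response rest
  have eW : (fun μ' y ν' y' => W2SymOfK G₀ n Sfl M0 S₂ M₂ μ' y ν' y' + X μ' y ν' y') = fun μ' y ν' y' =>
      (W2SymOfK K₀ n Sfl M0 S₂ M₂ μ' y ν' y'
          + (((comp (diagK fun z' b => (n : ℝ) ^ 4 / 2 * bmGaugeAt (ctr 4 n) (colH K₀ n ν' y') n (legSite (ctr 4 n) z' b)) (vertexOfK K₀ n Sfl μ' y)
                  - comp (vertexOfK K₀ n Sfl μ' y) (diagK fun z' b => (n : ℝ) ^ 4 / 2 * bmGaugeAt (ctr 4 n) (colH K₀ n ν' y') n (legSite (ctr 4 n) z' b)))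
              + (comp (diagK fun z' b => (n : ℝ) ^ 4 / 2 * bmGaugeAt (ctr 4 n) (colH K₀ n μ' y) n (legSite (ctr 4 n) z' b)) (vertexOfK K₀ n Sfl ν' y')
                  - comp (vertexOfK K₀ n Sfl ν' y') (diagK fun z' b => (n : ℝ) ^ 4 / 2 * bmGaugeAt (ctr 4 n) (colH K₀ n μ' y) n (legSite (ctr 4 n) z' b))))
            - ((comp (diagK fun z' b => (n : ℝ) ^ 4 / 2 * bmGaugeAt (ctr 4 n) (colH K₀ n ν' y') n (legSite (ctr 4 n) z' b)) (vertexOfK K₀ n S0 μ' y)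
                  - comp (vertexOfK K₀ n S0 μ' y) (diagK fun z' b => (n : ℝ) ^ 4 / 2 * bmGaugeAt (ctr 4 n) (colH K₀ n ν' y') n (legSite (ctr 4 n) z' b)))
              + (comp (diagK fun z' b => (n : ℝ) ^ 4 / 2 * bmGaugeAt (ctr 4 n) (colH K₀ n μ' y) n (legSite (ctr 4 n) z' b)) (vertexOfK K₀ n S0 ν' y')
                  - comp (vertexOfK K₀ n S0 ν' y') (diagK fun z' b => (n : ℝ) ^ 4 / 2 * bmGaugeAt (ctr 4 n) (colH K₀ n μ' y) n (legSite (ctr 4 n) z' b)))))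
          + ((mixOfK G₀ n M₂ μ' y ν' y' - mixOfK K₀ n M₂ μ' y ν' y') + (mixOfK G₀ n M₂ ν' y' μ' y - mixOfK K₀ n M₂ ν' y' μ' y))
          + X μ' y ν' y')
      + ((((comp (diagK fun z' b => (n : ℝ) ^ 4 / 2 * bmGaugeAt (ctr 4 n) (colH K₀ n ν' y') n (legSite (ctr 4 n) z' b)) (vertexOfK K₀ n S0 μ' y)
              - comp (vertexOfK K₀ n S0 μ' y) (diagK fun z' b => (n : ℝ) ^ 4 / 2 * bmGaugeAt (ctr 4 n) (colH K₀ n ν' y') n (legSite (ctr 4 n) z' b)))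
            + (comp (diagK fun z' b => (n : ℝ) ^ 4 / 2 * bmGaugeAt (ctr 4 n) (colH K₀ n μ' y) n (legSite (ctr 4 n) z' b)) (vertexOfK K₀ n S0 ν' y')
              - comp (vertexOfK K₀ n S0 ν' y') (diagK fun z' b => (n : ℝ) ^ 4 / 2 * bmGaugeAt (ctr 4 n) (colH K₀ n μ' y) n (legSite (ctr 4 n) z' b))))
          + (comp (diagK fun z' b => (n : ℝ) ^ 4 / 2 * bmGaugeAt (ctr 4 n) (colH K₀ n μ' y) n (legSite (ctr 4 n) z' b))
                (comp (diagK fun z' b => (n : ℝ) ^ 4 / 2 * bmGaugeAt (ctr 4 n) (colH K₀ n ν' y') n (legSite (ctr 4 n) z' b)) (bhK n + Dsh n)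
                  - comp (bhK n + Dsh n) (diagK fun z' b => (n : ℝ) ^ 4 / 2 * bmGaugeAt (ctr 4 n) (colH K₀ n ν' y') n (legSite (ctr 4 n) z' b)))
            - comp (comp (diagK fun z' b => (n : ℝ) ^ 4 / 2 * bmGaugeAt (ctr 4 n) (colH K₀ n ν' y') n (legSite (ctr 4 n) z' b)) (bhK n + Dsh n)
                  - comp (bhK n + Dsh n) (diagK fun z' b => (n : ℝ) ^ 4 / 2 * bmGaugeAt (ctr 4 n) (colH K₀ n ν' y') n (legSite (ctr 4 n) z' b)))
                (diagK fun z' b => (n : ℝ) ^ 4 / 2 * bmGaugeAt (ctr 4 n) (colH K₀ n μ' y) n (legSite (ctr 4 n) z' b))))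
        + (1 / 2 : ℝ) • ((dM (K2OfK G₀ n Sfl M0 ν' y') n Sfl M0 μ' y + dM (K2OfK G₀ n Sfl M0 μ' y) n Sfl M0 ν' y')
            - (dM (K2OfK K₀ n Sfl M0 ν' y') n Sfl M0 μ' y + dM (K2OfK K₀ n Sfl M0 μ' y) n Sfl M0 ν' y'))) := by
    funext μ' y ν' y'
    simp only [W2SymOfK, W2OfK_apply]
    rw [eP μ' y ν' y', eP ν' y' μ' y,
      Wgg_diagK_swap (fun z' b => (n : ℝ) ^ 4 / 2 * bmGaugeAt (ctr 4 n) (colH K₀ n μ' y) n (legSite (ctr 4 n) z' b))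
        (fun z' b => (n : ℝ) ^ 4 / 2 * bmGaugeAt (ctr 4 n) (colH K₀ n ν' y') n (legSite (ctr 4 n) z' b)) (bhK n + Dsh n)]
    funext x z' a b
    simp only [Pi.add_apply, Pi.sub_apply, Pi.smul_apply, smul_eq_mul]
    ring
  -- localisation of the displaced words
  have hWΛ : ∀ μ' y ν' y', Loc
      (((comp (diagK fun z' b => (n : ℝ) ^ 4 / 2 * bmGaugeAt (ctr 4 n) (colH K₀ n ν' y') n (legSite (ctr 4 n) z' b)) (vertexOfK K₀ n Sfl μ' y)
            - comp (vertexOfK K₀ n Sfl μ' y) (diagK fun z' b => (n : ℝ) ^ 4 / 2 * bmGaugeAt (ctr 4 n) (colH K₀ n ν' y') n (legSite (ctr 4 n) z' b)))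
          + (comp (diagK fun z' b => (n : ℝ) ^ 4 / 2 * bmGaugeAt (ctr 4 n) (colH K₀ n μ' y) n (legSite (ctr 4 n) z' b)) (vertexOfK K₀ n Sfl ν' y')
            - comp (vertexOfK K₀ n Sfl ν' y') (diagK fun z' b => (n : ℝ) ^ 4 / 2 * bmGaugeAt (ctr 4 n) (colH K₀ n μ' y) n (legSite (ctr 4 n) z' b))))
        - ((comp (diagK fun z' b => (n : ℝ) ^ 4 / 2 * bmGaugeAt (ctr 4 n) (colH K₀ n ν' y') n (legSite (ctr 4 n) z' b)) (vertexOfK K₀ n S0 μ' y)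
            - comp (vertexOfK K₀ n S0 μ' y) (diagK fun z' b => (n : ℝ) ^ 4 / 2 * bmGaugeAt (ctr 4 n) (colH K₀ n ν' y') n (legSite (ctr 4 n) z' b)))
          + (comp (diagK fun z' b => (n : ℝ) ^ 4 / 2 * bmGaugeAt (ctr 4 n) (colH K₀ n μ' y) n (legSite (ctr 4 n) z' b)) (vertexOfK K₀ n S0 ν' y')
            - comp (vertexOfK K₀ n S0 ν' y') (diagK fun z' b => (n : ℝ) ^ 4 / 2 * bmGaugeAt (ctr 4 n) (colH K₀ n μ' y) n (legSite (ctr 4 n) z' b))))) :=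
    fun μ' y ν' y' =>
      ((((hΛ ν' y').comp (hVfl μ' y)).sub ((hVfl μ' y).comp (hΛ ν' y'))).add
          (((hΛ μ' y).comp (hVfl ν' y')).sub ((hVfl ν' y').comp (hΛ μ' y)))).sub
        ((((hΛ ν' y').comp (hV μ' y)).sub ((hV μ' y).comp (hΛ ν' y'))).add
          (((hΛ μ' y).comp (hV ν' y')).sub ((hV ν' y').comp (hΛ μ' y))))
  have hWM : ∀ μ' y ν' y', Loc ((mixOfK G₀ n M₂ μ' y ν' y' - mixOfK K₀ n M₂ μ' y ν' y') + (mixOfK G₀ n M₂ ν' y' μ' y - mixOfK K₀ n M₂ ν' y' μ' y)) :=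
    fun μ' y ν' y' => ((hmixG μ' y ν' y').sub (hmixK μ' y ν' y')).add ((hmixG ν' y' μ' y).sub (hmixK ν' y' μ' y))
  have hW : ∀ μ' y ν' y', Loc (W2SymOfK K₀ n Sfl M0 S₂ M₂ μ' y ν' y'
      + (((comp (diagK fun z' b => (n : ℝ) ^ 4 / 2 * bmGaugeAt (ctr 4 n) (colH K₀ n ν' y') n (legSite (ctr 4 n) z' b)) (vertexOfK K₀ n Sfl μ' y)
            - comp (vertexOfK K₀ n Sfl μ' y) (diagK fun z' b => (n : ℝ) ^ 4 / 2 * bmGaugeAt (ctr 4 n) (colH K₀ n ν' y') n (legSite (ctr 4 n) z' b)))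
          + (comp (diagK fun z' b => (n : ℝ) ^ 4 / 2 * bmGaugeAt (ctr 4 n) (colH K₀ n μ' y) n (legSite (ctr 4 n) z' b)) (vertexOfK K₀ n Sfl ν' y')
            - comp (vertexOfK K₀ n Sfl ν' y') (diagK fun z' b => (n : ℝ) ^ 4 / 2 * bmGaugeAt (ctr 4 n) (colH K₀ n μ' y) n (legSite (ctr 4 n) z' b))))
        - ((comp (diagK fun z' b => (n : ℝ) ^ 4 / 2 * bmGaugeAt (ctr 4 n) (colH K₀ n ν' y') n (legSite (ctr 4 n) z' b)) (vertexOfK K₀ n S0 μ' y)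
            - comp (vertexOfK K₀ n S0 μ' y) (diagK fun z' b => (n : ℝ) ^ 4 / 2 * bmGaugeAt (ctr 4 n) (colH K₀ n ν' y') n (legSite (ctr 4 n) z' b)))
          + (comp (diagK fun z' b => (n : ℝ) ^ 4 / 2 * bmGaugeAt (ctr 4 n) (colH K₀ n μ' y) n (legSite (ctr 4 n) z' b)) (vertexOfK K₀ n S0 ν' y')
            - comp (vertexOfK K₀ n S0 ν' y') (diagK fun z' b => (n : ℝ) ^ 4 / 2 * bmGaugeAt (ctr 4 n) (colH K₀ n μ' y) n (legSite (ctr 4 n) z' b)))))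
      + ((mixOfK G₀ n M₂ μ' y ν' y' - mixOfK K₀ n M₂ μ' y ν' y') + (mixOfK G₀ n M₂ ν' y' μ' y - mixOfK K₀ n M₂ ν' y' μ' y))
      + X μ' y ν' y') :=
    fun μ' y ν' y' => (((hW2K μ' y ν' y').add (hWΛ μ' y ν' y')).add (hWM μ' y ν' y')).add (hX μ' y ν' y')
  have hNr : ∀ μ' y ν' y', Loc ((1 / 2 : ℝ) • ((dM (K2OfK G₀ n Sfl M0 ν' y') n Sfl M0 μ' y + dM (K2OfK G₀ n Sfl M0 μ' y) n Sfl M0 ν' y')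
      - (dM (K2OfK K₀ n Sfl M0 ν' y') n Sfl M0 μ' y + dM (K2OfK K₀ n Sfl M0 μ' y) n Sfl M0 ν' y'))) :=
    fun μ' y ν' y' => (((hRG μ' y ν' y').add (hRG ν' y' μ' y)).sub ((hRK μ' y ν' y').add (hRK ν' y' μ' y))).smul _
  have hN0 : ∀ μ' y ν' y', tadpole (GcombSh (d := 3) n 0) ((1 / 2 : ℝ) • ((dM (K2OfK G₀ n Sfl M0 ν' y') n Sfl M0 μ' y + dM (K2OfK G₀ n Sfl M0 μ' y) n Sfl M0 ν' y')
      - (dM (K2OfK K₀ n Sfl M0 ν' y') n Sfl M0 μ' y + dM (K2OfK K₀ n Sfl M0 μ' y) n Sfl M0 ν' y'))) = 0 := fun μ' y ν' y' => by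
    rw [tadpole_smul, tadpole_sub hG' ((hRG μ' y ν' y').add (hRG ν' y' μ' y)) ((hRK μ' y ν' y').add (hRK ν' y' μ' y)),
      tadpole_add hG' (hRG μ' y ν' y') (hRG ν' y' μ' y), tadpole_add hG' (hRK μ' y ν' y') (hRK ν' y' μ' y),
      h0G, h0G, h0K, h0K]
    ring
  -- the cancellation at the literal's pin
  rw [eV, eW]
  exact hessKer_GcombSh_cancel (Lc := n) (d := 3) hV hΛ hΛE hW hNr hN0 μ ν z

end Summit.QuantumFields.BalabanUV.Beta.D1BFx.ChartDefectLiteralColumnPin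

end
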